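import Summits.BirchSwinnertonDyer.Rank1Residual.Additive.TwistedBranchPAdicGrossZagierEndState
import Summits.BirchSwinnertonDyer.Rank1Residual.Additive.X3BranchGordEndStateThreeOfFacts
import Summits.BirchSwinnertonDyer.Rank1Residual.Additive.GordThreeDelbourgo2002Bridge
import Summits.BirchSwinnertonDyer.Rank1Residual.Additive.X3ThreeLineDatum
import Literature.NumberTheory.EllipticCurves.GreenbergVatsal2000.ResidualLiftingEven
import HarnessLib

/-!
# Row B6 (O7-ord), defect 2, RANK ONE at `p = 3`: `BSD(E,3)` on X3♯(G-ord) ∩ `r_an = 1` from PUBLISHED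
# facts + the cell's fact `delbourgoDatum_rankOne_leadingTerms` + the per-pair `3`-line datum + ONE number
# (cell `bsd-addord`, seat `bsd-addord-gz`, gen 4; sequel of `TwistedBranchPAdicGrossZagierEndState.lean`)

HONEST FRAMING (cell `bsd-addord`, FULL-BSD rank-≤ 1 programme D-0033 tranche 1a, `run/shared/lean/pub/bsd-addord/`;
PARTITION (D-0054): EXCLUDED-DOMAIN additive rows §E, B6 = O7-ord r1 — X3♯(G-ord, e = 2) ∩ `r_an = 1` × `p = 3`;
types-the-object-of / by-name closures only when the planner books; booked 0 by this file). THEOREMS ONLY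
(no `def`, no named fact, no `sorry`). The predecessor file (`…EndState.lean`, p403164) gave the rank-one
CLASS FORMS on X3♯(G-ord) ∩ `I₀*` at `p ≡ 1 (mod 4)` and at `p ≡ 3 (mod 4), p ≥ 7`; the largest X3 r1 block
of the residue is at `p = 3` (b2b RESIDUAL-MAP: X3 r = 1 @3), where the leading-term input is Delbourgo 2002
AT `3` (`Delbourgo2002.mainTheorem_three`, displayed `hDel3`; bridge `TypeGOrd.isTorsion_three_of_delbourgo2002`)
and the per-pair line datum is the `p = 3` one (`X3LineDatumThree W`: a rational line `Φ₀ ≤ W[3]`, EVEN, with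
non-trivial `Γ_ℚ`-action, `χ_K`-twist ramified — the 685 kernel records `x3LineDatumThree_<label>` of the twist
seat are its rank-zero instances), the residual LIFTING being the tree's even-line reading-fact
`residualEpsilon_surjOn_of_lineEven` (`hLiftE`, GV 2000 pp. 28–30), exactly as in the rank-zero intrinsic end
state `ClassX3Gord.bsdp_three_rankZero_of_facts_of_lineDatum_intrinsic` (p404507).

## What

* §1 `X3Branch.chiBranchLowerDivisibilityOddAt_of_facts_of_lifting` — every `p ≡ 3 (mod 4)`: the Λ-adic
  ODD containment `ChiBranchLowerDivisibilityOddAt W p` from `hW16 ∧ hGV ∧ h23 ∧ h414 ∧ hGrK` + the line datum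
  (EVEN, non-trivial action, `χ`-twist ramified; NO ramification-at-`p` hypothesis) + the DISPLAYED lifting
  `hlift` — the minus-branch twin of `X3Branch.chiBranchLowerDivisibilityAt_of_facts_of_lifting`, read off
  `X3Branch.charIdeal_eq_span_of_facts_of_lifting` (both parities).
* §2 **`ClassX3Gord.bsdp_three_rankOne_of_facts_of_delbourgoDatumFact_of_branchCoeffOneNeZero`** and its
  `X3LineDatumThree` wrapper `…_of_lineDatum`: X3♯(G-ord) at `p = 3` (defect `2` automatic), `E` non-CM,
  non-anomalous, `r_an(E) = 1`: `BSD(E,3)` from the PUBLISHED named facts (`hW16 hGV h23 h414 hGrK hLiftE hDel3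
  hmod hmodD hGZK`) + the cell's fact `hFact = Disegni2017.delbourgoDatum_rankOne_leadingTerms` (PROOF-gz
  Thm. 1 / Cor. 2 ∘ Delbourgo 2002 (B); REF-gz PASS with GZ-H; its `p = 3` clause = the third disjunct of
  `Delbourgo2002PrintedHypotheses`, supplied by `TypeGOrd` + `TypeGOrd.exists_goodOrd_twist_model_three`) +
  ONE analytic number `BranchCoeffOneNeZeroAt W 3` (`[T¹](ϖ·L⁻₃(f_V, α_V, ω¹, T)) ≠ 0`, the census's `A′ ≠ 0`
  = Schneider for the fact's datum, predecessor §0). Chain: (L) §1 with `hLiftE`; (GZ)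
  `branchPAdicGrossZagierOddAt_of_twisted`; (S) `schneiderConjecture_of_twisted_of_branchCoeffOneNeZero`;
  lower `cycLowerBoundAt_of_chiBranchLowerOdd_of_branchPAdicGrossZagierOdd` (p01, `p = 3` included) +
  `missingLowerBoundAt_of_cycLowerBound` (torsion from `hDel3`); upper
  `ClassX3Gord.missingUpperBoundAt_rankOne_of_wuthrichHalf_of_branchPAdicGrossZagierOdd`; glue
  `missingPPartAt_of_lower_of_upper`, `bsdp_of_missingPPartAt`.

## What is NOT claimed

No booking; nothing on the anomalous rows (`hna` displayed: Delbourgo's `ℓ₃(E)`), on X4 at `3`, on (M) at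
`3`, in rank `≠ 1`; Schneider only for the fact's datum from the per-pair number; `hFact` is the cell theorem
(displayed, never a theorem here); the per-pair inputs `X3LineDatumThree W` and `BranchCoeffOneNeZeroAt W 3`
are kernel records / numerical certificates supplied row by row by the twist seat / this seat.

References: [Delbourgo2002] Thm. (A), (B) p. 40, Hypothesis p. 39 (`p = 3` clause); [Disegni2017] Thm. A, B,
Rem. 1.3.2; [GreenbergVatsal2000] §2 (11), (16), pp. 28–30, §3 Thm. (3.12); [GreenbergLNM1716] Props. 2.2,
2.4, 4.14; [Wuthrich2014] Thm. 16; [MazurTateTeitelbaum1986Invent] §I.13–I.14; [Miller2011LMS] Def. 1.1;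
cell memo PROOF-gz.md §3.5 Remark (3) (`p = 3` allowed).
-/

set_option autoImplicit false

noncomputable section

open scoped Classical MatrixGroups ModularForm NumberField

open CongruenceSubgroup WeierstrassCurve NumberField IsDedekindDomain Field
  Literature.NumberTheory.EllipticCurves Literature.NumberTheory.EllipticCurves.ModularForms
  Literature.NumberTheory.EllipticCurves.GreenbergVatsal2000
  Literature.NumberTheory.EllipticCurves.Rank1Residual
  Literature.NumberTheory.EllipticCurves.Rank1Residual.Typed
  Literature.NumberTheory.EllipticCurves.Delbourgo2002
  Literature.NumberTheory.EllipticCurves.Disegni2017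
  Literature.NumberTheory.GaloisRepresentations
  Summit.BirchSwinnertonDyer.Rank1Residual.AdditivePotMult
  Summit.BirchSwinnertonDyer.Rank1Residual.Additive.X3Branch

namespace Summit.BirchSwinnertonDyer.Rank1Residual.Additive

/-! ### §1 `p ≡ 3 (mod 4)`: the Λ-adic ODD containment from published facts + line datum + displayed lifting -/

section OddLifting

variable {W : WeierstrassCurve ℚ} [W.IsElliptic] [W.IsGloballyMinimal] {p : ℕ} [hp : Fact p.Prime]

/-- **`p ≡ 3 (mod 4)`: `ChiBranchLowerDivisibilityOddAt W p` FROM PUBLISHED FACTS + the line data (EVEN,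
non-trivial `Γ_ℚ`-action, `χ_K`-twist ramified) + the DISPLAYED residual lifting `hlift`** — every
`g ∈ char_Λ X(W/ℚ_∞)` is `ι(h)·(ϖ·L⁻_p(f_V, α_V, ω^{(p−1)/2}, T))`; the minus-branch twin of
`X3Branch.chiBranchLowerDivisibilityAt_of_facts_of_lifting`, read off the both-parity `W`-level branch main
conjecture `X3Branch.charIdeal_eq_span_of_facts_of_lifting`. At `p = 3` the lifting is discharged by the
even-line reading-fact `residualEpsilon_surjOn_of_lineEven` (§2).
[cite: GreenbergVatsal2000, §2 (11), (16), pp. 28–30; §3 Thm. (3.12) p. 45] [cite: Wuthrich2014, Thm. 16 (p. 397)]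
[cite: GreenbergLNM1716, Props. 2.2, 2.4, 4.14] [cite: SkinnerUrban2014, Thm. 3.6.4 (p. 43) (shape only)] -/
theorem X3Branch.chiBranchLowerDivisibilityOddAt_of_facts_of_lifting
    (hW16 : Wuthrich2014.thm16_halfEigenCharIdeal_dvd_cyclotomicPrime)
    (hGV : thm312_branch_unitContent_and_lambda_eq_residual_goodOrd)
    (h23 : datumSelmer_nonPrimitive_invariants)
    (h414 : Greenberg1999.prop414_noFiniteSubmodule_of_not_dvd_torsionOrder)
    (hGrK : Greenberg1999.imKummer_ge_strictCondition_goodOrdinary)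
    (S₀ : Finset (HeightOneSpectrum (𝓞 ℚ))) (hS₀ : ∀ v ∈ S₀, ((p : ℕ) : 𝓞 ℚ) ∉ v.asIdeal)
    (hS : ∀ v : HeightOneSpectrum (𝓞 ℚ), v ∉ S₀ → ((p : ℕ) : 𝓞 ℚ) ∉ v.asIdeal →
      W.HasGoodReductionAt v)
    (Φ₀ : AddSubgroup (W.geomTorsion (p : ℤ))) (hΦ : IsRationalLine W p Φ₀)
    (heven : LineEven W p Φ₀)
    (hnt : ∃ (σ : absoluteGaloisGroup ℚ) (P : W.geomTorsion (p : ℤ)), P ∈ Φ₀ ∧ σ • P ≠ P)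
    (hram : ∀ (K : Type) [Field K] [NumberField K] [(galRange (K := ℚ) K).Normal],
      Module.finrank ℚ K = 2 → (∃ θ : K, θ ^ 2 = algebraMap ℚ K ((-1) ^ (p / 2) * p)) →
      ¬ ∀ v : HeightOneSpectrum (𝓞 ℚ), ((p : ℕ) : 𝓞 ℚ) ∈ v.asIdeal →
        ∀ 𝔓 ∈ v.primesAbove, ∀ σ ∈ 𝔓.inertia (absoluteGaloisGroup ℚ), ∀ P ∈ Φ₀,
          σ • P = (if σ ∈ galRange (K := ℚ) K then P else -P))
    (hlift : ∀ (κ : ZpExtension ℚ p) (S₀ : Finset (HeightOneSpectrum (𝓞 ℚ))), κ.IsCyclotomic →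
      (∀ v ∈ S₀, ((p : ℕ) : 𝓞 ℚ) ∉ v.asIdeal) →
      (∀ v : HeightOneSpectrum (𝓞 ℚ), v ∉ S₀ → ((p : ℕ) : 𝓞 ℚ) ∉ v.asIdeal → W.HasGoodReductionAt v) →
      ∀ s ∈ residualQuotSelmer W p κ S₀ Φ₀ hΦ, ∃ x ∈ residualTorsionH1 W p κ S₀,
        residualEpsilon W p κ Φ₀ hΦ x = s) :
    ChiBranchLowerDivisibilityOddAt W p := by
  intro V _ _ κ γ N _ f hp3 hCW hgood hκ hγ hcv hf D ϖ hϖ g hg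
  have hp2 : p ≠ 2 := by omega
  have hodd' : ¬ Even (p / 2) := by
    rw [Nat.not_even_iff_odd]
    exact ⟨p / 4, by omega⟩
  have hps : ((-1 : ℚ) ^ (p / 2) * (p : ℚ)) = -(p : ℚ) := by
    rw [pStar_eq_of_mod_four p (Or.inr hp3), if_neg (by omega)]
  obtain ⟨C, hC⟩ := hCW
  have hC' : C • V.quadraticTwist ((-1) ^ (p / 2) * p : ℚ) = W := by rw [hps]; exact hC
  obtain ⟨-, g', hchar, u, hι⟩ := X3Branch.charIdeal_eq_span_of_facts_of_lifting hW16 hGV h23 h414 hGrK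
    hp2 hgood hC' S₀ hS₀ hS Φ₀ hΦ heven hnt hram hlift hκ hγ hcv hf D ϖ (by rw [if_neg hodd']; exact hϖ)
  rw [if_neg hodd'] at hι
  have hg' : g ∈ Ideal.span ({g'} : Set (IwasawaAlgebra p)) := by rw [← hchar]; exact hg
  obtain ⟨a, rfl⟩ := Ideal.mem_span_singleton'.mp hg'
  refine ⟨PowerSeries.C (u : ℤ_[p]) * a, ?_⟩
  have hCu : PowerSeries.C ((((u : ℤ_[p]) : ℚ_[p])) * (ϖ : ℚ_[p])) =
      PowerSeries.C (((u : ℤ_[p]) : ℚ_[p])) * PowerSeries.C (ϖ : ℚ_[p]) := map_mul _ _ _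
  rw [map_mul, hι, iwasawaToPowerSeries_C_mul', hCu]
  ring

end OddLifting

/-! ### §2 X3♯(G-ord) at `p = 3`, rank one: `BSD(E,3)` from PUBLISHED facts + the fact + the line datum + one number -/

section Three

variable {W : WeierstrassCurve ℚ} [W.IsElliptic] [W.IsGloballyMinimal]

/-- **X3♯(G-ord) AT `p = 3` (defect `2` automatic), `E` non-CM, `r_an(E) = 1`, non-anomalous, `p = 3` line
position (`Φ₀ ≤ W[3]` rational, EVEN, non-trivial `Γ_ℚ`-action, `χ_K`-twist ramified): `BSD(E,3)` from
PUBLISHED named facts + the cell's fact `hFact` + ONE analytic number (`BranchCoeffOneNeZeroAt W 3`).**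
Published binders: Wuthrich 2014 Thm. 16 (`hW16`), GV 2000 Thm. (3.12)/§2 (`hGV`, `h23`), GV pp. 28–30 even-line
lifting (`hLiftE`), Greenberg 1999 (`h414`, `hGrK`), Delbourgo 2002 (A)+(B) AT `3` (`hDel3`), modularity
(`hmod`, `hmodD`), GZK (`hGZK`). Chain: (L) §1 with `hlift := hLiftE`; (GZ) the fact at `p = 3` (third
disjunct of `Delbourgo2002PrintedHypotheses`: `TypeGOrd W 3` + a good ordinary quadratic twist,
`TypeGOrd.exists_goodOrd_twist_model_three`) and `branchPAdicGrossZagierOddAt_of_twisted`; (S)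
`schneiderConjecture_of_twisted_of_branchCoeffOneNeZero`; lower half
`cycLowerBoundAt_of_chiBranchLowerOdd_of_branchPAdicGrossZagierOdd` (at `3`) + `missingLowerBoundAt_of_cycLowerBound`
(torsion `TypeGOrd.isTorsion_three_of_delbourgo2002`); upper half
`ClassX3Gord.missingUpperBoundAt_rankOne_of_wuthrichHalf_of_branchPAdicGrossZagierOdd`; glue
`missingPPartAt_of_lower_of_upper`. The ONE non-published input is `hFact` (PROOF-gz Thm. 1, REF-gz PASS with
GZ-H; `p = 3` is inside its hypotheses: memo §3.5 Remark (3)). Nothing booked.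
[cite: Delbourgo2002, Theorem (A), (B) (p. 40); Hypothesis (p. 39)] [cite: GreenbergVatsal2000, §2 (11), (16), pp. 28–30, §3 Thm. (3.12) p. 45]
[cite: Wuthrich2014, Thm. 16 (p. 397)] [cite: GreenbergLNM1716, Props. 2.2, 2.4, 4.14] [cite: Miller2011LMS, Def. 1.1] -/
theorem ClassX3Gord.bsdp_three_rankOne_of_facts_of_delbourgoDatumFact_of_branchCoeffOneNeZero
    [hp : Fact (Nat.Prime 3)]
    (hW16 : Wuthrich2014.thm16_halfEigenCharIdeal_dvd_cyclotomicPrime)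
    (hGV : thm312_branch_unitContent_and_lambda_eq_residual_goodOrd)
    (h23 : datumSelmer_nonPrimitive_invariants)
    (h414 : Greenberg1999.prop414_noFiniteSubmodule_of_not_dvd_torsionOrder)
    (hGrK : Greenberg1999.imKummer_ge_strictCondition_goodOrdinary)
    (hLiftE : residualEpsilon_surjOn_of_lineEven)
    (hFact : delbourgoDatum_rankOne_leadingTerms) (hDel3 : Delbourgo2002.mainTheorem_three)
    (hmod : hasEntireLFunction_rat) (hmodD : nonempty_modularParametrizationData)
    (hGZK : rank_eq_analyticRank_of_analyticRank_le_one)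
    (hX : ClassX3Gord W 3) (hcm : ¬ W.HasCM) (hna : ReductionNonAnomalous W 3) (hr : W.analyticRank = 1)
    (Φ₀ : AddSubgroup (W.geomTorsion ((3 : ℕ) : ℤ))) (hΦ : IsRationalLine W 3 Φ₀)
    (heven : LineEven W 3 Φ₀)
    (hnt : ∃ (σ : absoluteGaloisGroup ℚ) (P : W.geomTorsion ((3 : ℕ) : ℤ)), P ∈ Φ₀ ∧ σ • P ≠ P)
    (hram : ∀ (K : Type) [Field K] [NumberField K] [(galRange (K := ℚ) K).Normal],
      Module.finrank ℚ K = 2 →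
      (∃ θ : K, θ ^ 2 = algebraMap ℚ K ((-1) ^ ((3 : ℕ) / 2) * (3 : ℕ))) →
      ¬ ∀ v : HeightOneSpectrum (𝓞 ℚ), (((3 : ℕ) : ℕ) : 𝓞 ℚ) ∈ v.asIdeal →
        ∀ 𝔓 ∈ v.primesAbove, ∀ σ ∈ 𝔓.inertia (absoluteGaloisGroup ℚ), ∀ P ∈ Φ₀,
          σ • P = (if σ ∈ galRange (K := ℚ) K then P else -P))
    (hne : BranchCoeffOneNeZeroAt W 3) : BSDp W 3 := by
  have hp4 : (3 : ℕ) % 4 = 3 := by norm_num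
  have he : semistabilityIndex W 3 = 2 :=
    semistabilityIndex_eq_two_of_typeG_three W hX.typeGOrd.typeG hX.addv
  -- (L) from published facts + the line data + the even-line lifting, odd branch
  obtain ⟨S₀, hS₀, hS⟩ := X2.GreenbergVatsalCaseOne.exists_finset_bad_not_mem W 3
  have hdiv : ChiBranchLowerDivisibilityOddAt W 3 :=
    X3Branch.chiBranchLowerDivisibilityOddAt_of_facts_of_lifting hW16 hGV h23 h414 hGrK S₀ hS₀ hS Φ₀ hΦ
      heven hnt hram (fun κ S₀ hκ hS₀ hS ↦ hLiftE W 3 κ S₀ Φ₀ hΦ (by norm_num) hκ heven hS₀ hS)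
  -- the fact's datum at `p = 3`: (B) + (GZ)
  obtain ⟨Dh, hB, hTw⟩ := hFact W 3 (by norm_num) hcm hX.addv hr
    (Or.inr (Or.inr ⟨rfl, hX.typeGOrd, hX.typeGOrd.exists_goodOrd_twist_model_three hX.addv⟩))
  have hGZ : BranchPAdicGrossZagierOddAt W 3 Dh := branchPAdicGrossZagierOddAt_of_twisted hGZK hr hTw
  -- the twist model and (S)
  obtain ⟨V, iV, iVm, C, hV, hC⟩ := hX.exists_goodOrd_pStar_twist_model W 3 (by norm_num) he
  have hS : SchneiderConjecture Dh :=
    schneiderConjecture_of_twisted_of_branchCoeffOneNeZero (by norm_num) hmodD hr hTw hne V C hC hV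
  -- lower half at the datum
  haveI : NeZero (V.conductorNorm ℤ) := ⟨(V.conductorNorm_pos_holds).ne'⟩
  obtain ⟨Dm⟩ := hmodD V
  obtain ⟨ϖ, -, hϖ⟩ := exists_rat_mul_imaginaryPeriodRat_eq_minusPeriod Dm
  have hps : ((-1 : ℚ) ^ ((3 : ℕ) / 2) * ((3 : ℕ) : ℚ)) = -((3 : ℕ) : ℚ) := by norm_num
  have hVW : ∃ C : VariableChange ℚ, C • V.quadraticTwist (-((3 : ℕ) : ℚ)) = W :=
    ⟨C, by rw [← hps]; exact hC⟩
  have hlow : CycLowerBoundAt W 3 Dh :=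
    cycLowerBoundAt_of_chiBranchLowerOdd_of_branchPAdicGrossZagierOdd W 3 hmod hGZK hX.addv hr hp4 V hVW
      hV Dm.isNewformOf ϖ hϖ hdiv hGZ
  have hl : MissingLowerBoundAt W 3 :=
    missingLowerBoundAt_of_cycLowerBound W 3 hB hS
      (fun κ γ hκ hγ D ↦ TypeGOrd.isTorsion_three_of_delbourgo2002 hDel3 hX.typeGOrd hX.addv hcm hκ hγ D)
      hGZK (by rw [hr]) hna hlow
  -- upper half at the datum, and the glue
  have hu : MissingUpperBoundAt W 3 :=
    hX.missingUpperBoundAt_rankOne_of_wuthrichHalf_of_branchPAdicGrossZagierOdd hW16 hGZK hmod hmodD he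
      hp4 hr hB hS hGZ
  exact bsdp_of_missingPPartAt W 3 hGZK (by rw [hr]) (missingPPartAt_of_lower_of_upper W 3 hl hu)

/-- **`p = 3` with the line datum as ONE predicate** (per-pair records `x3LineDatumThree_<label>`):
`BSD(E,3)` on X3♯(G-ord, `e = 2`) ∩ `r_an = 1`, `E` non-CM, non-anomalous, from the published facts + the
cell's fact `hFact` + `BranchCoeffOneNeZeroAt W 3`. [cite: Delbourgo2002, Theorem (A), (B) (p. 40)]
[cite: GreenbergVatsal2000, §2 (11), (16), pp. 28–30, §3 Thm. (3.12) p. 45] [cite: Wuthrich2014, Thm. 16 (p. 397)]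
[cite: Miller2011LMS, Def. 1.1] -/
theorem ClassX3Gord.bsdp_three_rankOne_of_facts_of_delbourgoDatumFact_of_lineDatum_of_branchCoeffOneNeZero
    [Fact (Nat.Prime 3)]
    (hW16 : Wuthrich2014.thm16_halfEigenCharIdeal_dvd_cyclotomicPrime)
    (hGV : thm312_branch_unitContent_and_lambda_eq_residual_goodOrd)
    (h23 : datumSelmer_nonPrimitive_invariants)
    (h414 : Greenberg1999.prop414_noFiniteSubmodule_of_not_dvd_torsionOrder)
    (hGrK : Greenberg1999.imKummer_ge_strictCondition_goodOrdinary)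
    (hLiftE : residualEpsilon_surjOn_of_lineEven)
    (hFact : delbourgoDatum_rankOne_leadingTerms) (hDel3 : Delbourgo2002.mainTheorem_three)
    (hmod : hasEntireLFunction_rat) (hmodD : nonempty_modularParametrizationData)
    (hGZK : rank_eq_analyticRank_of_analyticRank_le_one)
    (hX : ClassX3Gord W 3) (hcm : ¬ W.HasCM) (hna : ReductionNonAnomalous W 3) (hr : W.analyticRank = 1)
    (hL : X3LineDatumThree W) (hne : BranchCoeffOneNeZeroAt W 3) : BSDp W 3 := by
  obtain ⟨Φ₀, hΦ, heven, hnt, hram⟩ := hL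
  exact ClassX3Gord.bsdp_three_rankOne_of_facts_of_delbourgoDatumFact_of_branchCoeffOneNeZero hW16 hGV h23
    h414 hGrK hLiftE hFact hDel3 hmod hmodD hGZK hX hcm hna hr Φ₀ hΦ heven hnt hram hne

end Three

end Summit.BirchSwinnertonDyer.Rank1Residual.Additive

end
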